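import Literature.NumberTheory.LFunctions.BCHCrossTermErrorSums
import Literature.NumberTheory.LFunctions.BCHCrossTermWeights
import HarnessLib

/-!
# The cross term of the BCH mean square: the weighted error sum, families `E₀` and `E_D`

Topic `Literature/NumberTheory/LFunctions`. Everything in this file is PROVED (no definitions, no
named facts).

Continuation of `Literature/NumberTheory/LFunctions/BCHCrossTermErrorSums.lean` (kernel bound and
inner `ν`-sums): here the quadruple sums of the constant family and of the two fixed-level families
`D = T`, `D = T'` of the stationary-phase error of the cross term of the Balasubramanian–Conrey–
Heath-Brown mean square (named fact
`Literature.Barriers.RiemannHypothesis.BalasubramanianConreyHeathBrown1985_meanSquare`) are bounded: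

* `BCH.sum_weight_le` — `Σ_{h,k ≤ N} Σ_{μ,ν ≤ X} |a_h||a_k|(hk)^{-1/2}(μν)^{-1/2} ≤ 16 B² N X`;
* `BCH.sum_weight_kernel_le` — for `0 < T ≤ D`:
  `Σ |a_h||a_k|(hk)^{-1/2}(μν)^{-1/2} · 8T/(|c − D| + √(2T)) ≤ B² N (1 + log N)(8Λ_D(1 + log X)√(T/2π) + 24√π X)`,
  `Λ_D = 13 + 3 log X + 3 log(DN + 2)` — i.e. `O(B² N √T log³)` for `X ≍ √T`.

## References

* [Levinson1974] N. Levinson, Adv. Math. 13 (1974), §5.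
-/

noncomputable section

open Finset Real

namespace Literature.NumberTheory.LFunctions.BCH

/-! ### Harmonic bookkeeping -/

/-- `Σ_{h ≤ N} ‖a_h‖/√h ≤ 2B√N` when `‖a_h‖ ≤ B`. [folklore] -/
theorem sum_norm_div_sqrt_le (a : ℕ → ℂ) {N : ℕ} {B : ℝ} (hB : ∀ h ∈ Finset.Icc 1 N, ‖a h‖ ≤ B) :
    ∑ h ∈ Finset.Icc 1 N, ‖a h‖ * (1 / Real.sqrt h) ≤ B * (2 * Real.sqrt N) := by
  calc ∑ h ∈ Finset.Icc 1 N, ‖a h‖ * (1 / Real.sqrt h) ≤ ∑ h ∈ Finset.Icc 1 N, B * (1 / Real.sqrt h) :=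
        Finset.sum_le_sum fun h hh => mul_le_mul_of_nonneg_right (hB h hh) (by positivity)
    _ = B * ∑ h ∈ Finset.Icc 1 N, 1 / Real.sqrt h := by rw [Finset.mul_sum]
    _ ≤ B * (2 * Real.sqrt N) := by
        rcases Nat.eq_zero_or_pos N with rfl | hN
        · simp
        · have hB0 : 0 ≤ B := le_trans (norm_nonneg _) (hB 1 (Finset.mem_Icc.2 ⟨le_rfl, hN⟩))
          exact mul_le_mul_of_nonneg_left (sum_one_div_sqrt_le N) hB0

/-! ### (E₀) the constant family -/

/-- **(E₀)** `Σ_{h,k ≤ N} Σ_{μ,ν ≤ X} |a_h||a_k|(hk)^{-1/2}(μν)^{-1/2} ≤ 16 B² N X`. [folklore] -/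
theorem sum_weight_le (a : ℕ → ℂ) (N X : ℕ) {B : ℝ} (hB : ∀ h ∈ Finset.Icc 1 N, ‖a h‖ ≤ B) :
    ∑ h ∈ Finset.Icc 1 N, ∑ k ∈ Finset.Icc 1 N, ∑ μ ∈ Finset.Icc 1 X, ∑ ν ∈ Finset.Icc 1 X,
      ‖a h‖ * ‖a k‖ * ((h : ℝ) * k) ^ (-(1 / 2 : ℝ)) * ((μ : ℝ) * ν) ^ (-(1 / 2 : ℝ)) ≤
      16 * B ^ 2 * N * X := by
  rcases Nat.eq_zero_or_pos N with rfl | hN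
  · simp
  have hB0 : 0 ≤ B := le_trans (norm_nonneg _) (hB 1 (Finset.mem_Icc.2 ⟨le_rfl, hN⟩))
  set f : ℕ → ℝ := fun h => ‖a h‖ * (1 / Real.sqrt h) with hf
  set g : ℕ → ℝ := fun μ => 1 / Real.sqrt μ with hg
  have hsummand : ∀ h k μ ν : ℕ,
      ‖a h‖ * ‖a k‖ * ((h : ℝ) * k) ^ (-(1 / 2 : ℝ)) * ((μ : ℝ) * ν) ^ (-(1 / 2 : ℝ)) =
        f h * (f k * (g μ * g ν)) := by
    intro h k μ ν
    rw [mul_assoc (‖a h‖ * ‖a k‖), weight_factor, hf, hg]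
    ring
  simp_rw [hsummand, ← Finset.mul_sum]
  rw [← Finset.sum_mul, ← Finset.sum_mul, ← Finset.sum_mul]
  have hF : ∑ h ∈ Finset.Icc 1 N, f h ≤ B * (2 * Real.sqrt N) := sum_norm_div_sqrt_le a hB
  have hG : ∑ μ ∈ Finset.Icc 1 X, g μ ≤ 2 * Real.sqrt X := sum_one_div_sqrt_le X
  have hF0 : 0 ≤ ∑ h ∈ Finset.Icc 1 N, f h := Finset.sum_nonneg fun h _ => by positivity
  have hG0 : 0 ≤ ∑ μ ∈ Finset.Icc 1 X, g μ := Finset.sum_nonneg fun μ _ => by positivity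
  have hNN : Real.sqrt N ^ 2 = N := Real.sq_sqrt (Nat.cast_nonneg N)
  have hXX : Real.sqrt X ^ 2 = X := Real.sq_sqrt (Nat.cast_nonneg X)
  calc (∑ h ∈ Finset.Icc 1 N, f h) * ((∑ k ∈ Finset.Icc 1 N, f k) *
        ((∑ μ ∈ Finset.Icc 1 X, g μ) * ∑ ν ∈ Finset.Icc 1 X, g ν))
      ≤ (B * (2 * Real.sqrt N)) * ((B * (2 * Real.sqrt N)) * ((2 * Real.sqrt X) * (2 * Real.sqrt X))) := by
        gcongr
    _ = 16 * B ^ 2 * Real.sqrt N ^ 2 * Real.sqrt X ^ 2 := by ring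
    _ = 16 * B ^ 2 * N * X := by rw [hNN, hXX]

/-! ### (E_D) the two fixed-level families `D = T`, `D = T'` -/

/-- `D/κ + 2 ≤ DN + 2` for `κ = 2πμh/k`, `1 ≤ k ≤ N`, `μ, h ≥ 1`, `D ≥ 0` (`2πμh ≥ 1`, `N/k ≥ 1`). [folklore] -/
theorem level_div_slope_le {h k μ N : ℕ} (hh : 0 < h) (hk : 0 < k) (hμ : 0 < μ) (hkN : k ≤ N) {D : ℝ}
    (hD : 0 ≤ D) : D / (2 * π * (μ : ℝ) * h / k) + 2 ≤ D * N + 2 := by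
  have hhR : (1 : ℝ) ≤ h := by exact_mod_cast hh
  have hkR : (0 : ℝ) < k := by exact_mod_cast hk
  have hμR : (1 : ℝ) ≤ μ := by exact_mod_cast hμ
  have hkN' : (k : ℝ) ≤ N := by exact_mod_cast hkN
  have hκ0 : 0 < 2 * π * (μ : ℝ) * h / k := slope_pos hh hk hμ
  have h1 : (1 : ℝ) ≤ 2 * π * (μ : ℝ) * h := by
    have : (1 : ℝ) ≤ (μ : ℝ) * h := by nlinarith
    nlinarith [Real.pi_gt_three]
  -- `D/κ = Dk/(2πμh) ≤ Dk ≤ DN`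
  have h2 : D / (2 * π * (μ : ℝ) * h / k) ≤ D * k := by
    rw [div_le_iff₀ hκ0]
    have : D * k * (2 * π * (μ : ℝ) * h / k) = D * (2 * π * (μ : ℝ) * h) := by field_simp
    rw [this]
    nlinarith
  nlinarith [mul_le_mul_of_nonneg_left hkN' hD]

/-- First numeric step: for `0 < T ≤ D`, `Λ ≥ 0`, `x > 0`:
`8T · Λ/(√(2πD)·x) ≤ 8Λ√(T/2π) · (1/x)`. [folklore] -/
theorem first_term_le {T D Λ x : ℝ} (hT : 0 < T) (hD : T ≤ D) (hΛ : 0 ≤ Λ) (hx : 0 < x) :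
    8 * T * (Λ * (1 / (Real.sqrt (2 * π * D) * x))) ≤ 8 * Λ * Real.sqrt (T / (2 * π)) * (1 / x) := by
  have hD0 : 0 < D := lt_of_lt_of_le hT hD
  have hsD : 0 < Real.sqrt D := Real.sqrt_pos.2 hD0
  have hsT : 0 < Real.sqrt T := Real.sqrt_pos.2 hT
  have h2π : 0 < Real.sqrt (2 * π) := Real.sqrt_pos.2 (by positivity)
  have e1 : Real.sqrt (2 * π * D) = Real.sqrt (2 * π) * Real.sqrt D := Real.sqrt_mul (by positivity) D
  have e2 : Real.sqrt (T / (2 * π)) = Real.sqrt T / Real.sqrt (2 * π) := Real.sqrt_div' T (by positivity)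
  have hkey : T / Real.sqrt D ≤ Real.sqrt T := by
    rw [div_le_iff₀ hsD]
    have := Real.sqrt_le_sqrt hD
    nlinarith [Real.mul_self_sqrt hT.le]
  rw [e1, e2]
  have lhs : 8 * T * (Λ * (1 / (Real.sqrt (2 * π) * Real.sqrt D * x))) =
      (8 * Λ / (Real.sqrt (2 * π) * x)) * (T / Real.sqrt D) := by
    field_simp
  have rhs : 8 * Λ * (Real.sqrt T / Real.sqrt (2 * π)) * (1 / x) =
      (8 * Λ / (Real.sqrt (2 * π) * x)) * Real.sqrt T := by
    field_simp
  rw [lhs, rhs]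
  exact mul_le_mul_of_nonneg_left hkey (by positivity)

/-- Second numeric step: for `0 < T ≤ D`, `x > 0`:
`8T · (3/(√(2T)√D)) · (√(2π)/x) ≤ 24√π · (1/x)`. [folklore] -/
theorem second_term_le {T D x : ℝ} (hT : 0 < T) (hD : T ≤ D) (hx : 0 < x) :
    8 * T * (3 / (Real.sqrt (2 * T) * Real.sqrt D) * (Real.sqrt (2 * π) / x)) ≤ 24 * Real.sqrt π * (1 / x) := by
  have hD0 : 0 < D := lt_of_lt_of_le hT hD
  have hsD : 0 < Real.sqrt D := Real.sqrt_pos.2 hD0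
  have hsT : 0 < Real.sqrt T := Real.sqrt_pos.2 hT
  have hs2 : 0 < Real.sqrt 2 := Real.sqrt_pos.2 (by norm_num)
  have hsπ : 0 < Real.sqrt π := Real.sqrt_pos.2 Real.pi_pos
  have e3 : Real.sqrt (2 * T) = Real.sqrt 2 * Real.sqrt T := Real.sqrt_mul (by norm_num) T
  have e4 : Real.sqrt (2 * π) = Real.sqrt 2 * Real.sqrt π := Real.sqrt_mul (by norm_num) π
  have hkey : T / (Real.sqrt T * Real.sqrt D) ≤ 1 := by
    rw [div_le_one (by positivity)]
    have := Real.sqrt_le_sqrt hD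
    nlinarith [Real.mul_self_sqrt hT.le]
  rw [e3, e4]
  have lhs : 8 * T * (3 / (Real.sqrt 2 * Real.sqrt T * Real.sqrt D) * (Real.sqrt 2 * Real.sqrt π / x)) =
      (24 * Real.sqrt π * (1 / x)) * (T / (Real.sqrt T * Real.sqrt D)) := by
    field_simp
    norm_num
  rw [lhs]
  have h0 : 0 ≤ 24 * Real.sqrt π * (1 / x) := by positivity
  calc (24 * Real.sqrt π * (1 / x)) * (T / (Real.sqrt T * Real.sqrt D))
      ≤ (24 * Real.sqrt π * (1 / x)) * 1 := mul_le_mul_of_nonneg_left hkey h0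
    _ = 24 * Real.sqrt π * (1 / x) := mul_one _

/-- **The `ν`-sum of one triple `(h,k,μ)` for the level `D`**: for `0 < T ≤ D`, `1 ≤ k ≤ N`, `h, μ ≥ 1`,
`|a_h|, |a_k| ≤ B`:
`Σ_{ν ≤ X} |a_h||a_k|(hk)^{-1/2}(μν)^{-1/2} 8T/(|c − D| + √(2T)) ≤ B²(8Λ_D√(T/2π)/(hμ) + 24√π/k)`.
[cite: Levinson1974, §5] -/
theorem kernel_triple_le (a : ℕ → ℂ) {N X : ℕ} {T D B : ℝ} (hT : 0 < T) (hD : T ≤ D) (hB0 : 0 ≤ B)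
    {h k μ : ℕ} (hh : 0 < h) (hk : 0 < k) (hμ : 0 < μ) (hkN : k ≤ N) (hah : ‖a h‖ ≤ B) (hak : ‖a k‖ ≤ B) :
    ∑ ν ∈ Finset.Icc 1 X, ‖a h‖ * ‖a k‖ * ((h : ℝ) * k) ^ (-(1 / 2 : ℝ)) * ((μ : ℝ) * ν) ^ (-(1 / 2 : ℝ)) *
        (8 * T / (|crossFreq h k μ ν - D| + Real.sqrt (2 * T))) ≤
      B ^ 2 * ((8 * (13 + 3 * Real.log X + 3 * Real.log (D * N + 2)) * Real.sqrt (T / (2 * π))) *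
          (1 / ((h : ℝ) * μ)) + (24 * Real.sqrt π) * (1 / (k : ℝ))) := by
  have hD0 : 0 < D := lt_of_lt_of_le hT hD
  have hs : 0 < Real.sqrt (2 * T) := Real.sqrt_pos.2 (by linarith)
  have hhR : (0 : ℝ) < h := by exact_mod_cast hh
  have hkR : (0 : ℝ) < k := by exact_mod_cast hk
  have hμR : (0 : ℝ) < μ := by exact_mod_cast hμ
  set Λ : ℝ := 13 + 3 * Real.log X + 3 * Real.log (D * N + 2) with hΛ
  have hlogX : 0 ≤ Real.log (X : ℝ) := Real.log_natCast_nonneg X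
  have hΛ0 : 0 ≤ Λ := by
    rw [hΛ]
    have : 0 ≤ Real.log (D * N + 2) :=
      Real.log_nonneg (by nlinarith [hD0.le, (Nat.cast_nonneg N : (0:ℝ) ≤ N)])
    positivity
  set κ : ℝ := 2 * π * (μ : ℝ) * h / k with hκ
  have hκ0 : 0 < κ := slope_pos hh hk hμ
  -- factor the ν-sum
  have hfac : ∀ ν ∈ Finset.Icc 1 X,
      ‖a h‖ * ‖a k‖ * ((h : ℝ) * k) ^ (-(1 / 2 : ℝ)) * ((μ : ℝ) * ν) ^ (-(1 / 2 : ℝ)) *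
        (8 * T / (|crossFreq h k μ ν - D| + Real.sqrt (2 * T))) =
      (‖a h‖ * ‖a k‖ * (((h : ℝ) * k) ^ (-(1 / 2 : ℝ)) * (μ : ℝ) ^ (-(1 / 2 : ℝ))) * (8 * T)) *
        ((ν : ℝ) ^ (-(1 / 2 : ℝ)) / (|κ * ν - D| + Real.sqrt (2 * T))) := by
    intro ν _
    rw [rpow_mul_natCast μ ν, show crossFreq h k μ ν = κ * ν by rw [crossFreq_def, hκ]; ring]
    ring
  rw [Finset.sum_congr rfl hfac, ← Finset.mul_sum]
  have hinner := inner_tail_le hκ0 hD0 hs X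
  have hw1 := weight_div_sqrt_slope_mul hh hk hμ hD0
  have hw2 := weight_mul_sqrt_slope hh hk hμ
  rw [← hκ] at hw1 hw2
  have hΛ' : 13 + 3 * Real.log X + 3 * Real.log (D / κ + 2) ≤ Λ := by
    rw [hΛ]
    have := level_div_slope_le hh hk hμ hkN hD0.le
    rw [← hκ] at this
    have hpos : 0 < D / κ + 2 := by positivity
    linarith [Real.log_le_log hpos this]
  have hW0 : 0 ≤ ‖a h‖ * ‖a k‖ * (((h : ℝ) * k) ^ (-(1 / 2 : ℝ)) * (μ : ℝ) ^ (-(1 / 2 : ℝ))) * (8 * T) := by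
    positivity
  have hwt0 : 0 ≤ ((h : ℝ) * k) ^ (-(1 / 2 : ℝ)) * (μ : ℝ) ^ (-(1 / 2 : ℝ)) := by positivity
  have t1 := first_term_le (x := (h : ℝ) * μ) hT hD hΛ0 (by positivity)
  have t2 := second_term_le (x := (k : ℝ)) hT hD hkR
  have hab : ‖a h‖ * ‖a k‖ ≤ B * B := mul_le_mul hah hak (norm_nonneg _) hB0
  calc (‖a h‖ * ‖a k‖ * (((h : ℝ) * k) ^ (-(1 / 2 : ℝ)) * (μ : ℝ) ^ (-(1 / 2 : ℝ))) * (8 * T)) *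
        ∑ ν ∈ Finset.Icc 1 X, (ν : ℝ) ^ (-(1 / 2 : ℝ)) / (|κ * ν - D| + Real.sqrt (2 * T))
      ≤ (‖a h‖ * ‖a k‖ * (((h : ℝ) * k) ^ (-(1 / 2 : ℝ)) * (μ : ℝ) ^ (-(1 / 2 : ℝ))) * (8 * T)) *
        (Λ / Real.sqrt (κ * D) + 3 * Real.sqrt κ / (Real.sqrt (2 * T) * Real.sqrt D)) := by
        refine mul_le_mul_of_nonneg_left (hinner.trans ?_) hW0
        gcongr
    _ = (‖a h‖ * ‖a k‖) * (8 * T * (Λ * (((h : ℝ) * k) ^ (-(1 / 2 : ℝ)) * (μ : ℝ) ^ (-(1 / 2 : ℝ)) /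
            Real.sqrt (κ * D))) + 8 * T * (3 / (Real.sqrt (2 * T) * Real.sqrt D) *
            (((h : ℝ) * k) ^ (-(1 / 2 : ℝ)) * (μ : ℝ) ^ (-(1 / 2 : ℝ)) * Real.sqrt κ))) := by ring
    _ = (‖a h‖ * ‖a k‖) * (8 * T * (Λ * (1 / (Real.sqrt (2 * π * D) * h * μ))) +
          8 * T * (3 / (Real.sqrt (2 * T) * Real.sqrt D) * (Real.sqrt (2 * π) / k))) := by rw [hw1, hw2]
    _ ≤ (B * B) * ((8 * Λ * Real.sqrt (T / (2 * π))) * (1 / ((h : ℝ) * μ)) +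
          (24 * Real.sqrt π) * (1 / (k : ℝ))) := by
        have h0 : 0 ≤ 8 * T * (Λ * (1 / (Real.sqrt (2 * π * D) * h * μ))) +
            8 * T * (3 / (Real.sqrt (2 * T) * Real.sqrt D) * (Real.sqrt (2 * π) / k)) := by positivity
        have h1 : 8 * T * (Λ * (1 / (Real.sqrt (2 * π * D) * h * μ))) +
            8 * T * (3 / (Real.sqrt (2 * T) * Real.sqrt D) * (Real.sqrt (2 * π) / k)) ≤
            (8 * Λ * Real.sqrt (T / (2 * π))) * (1 / ((h : ℝ) * μ)) + (24 * Real.sqrt π) * (1 / (k : ℝ)) := by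
          have t1' : 8 * T * (Λ * (1 / (Real.sqrt (2 * π * D) * h * μ))) ≤
              8 * Λ * Real.sqrt (T / (2 * π)) * (1 / ((h : ℝ) * μ)) := by
            rw [show Real.sqrt (2 * π * D) * h * μ = Real.sqrt (2 * π * D) * ((h : ℝ) * μ) by ring]
            exact t1
          linarith
        exact mul_le_mul hab h1 h0 (by positivity)
    _ = _ := by ring

/-- **(E_D)** For `0 < T ≤ D`:
`Σ_{h,k ≤ N} Σ_{μ,ν ≤ X} |a_h||a_k|(hk)^{-1/2}(μν)^{-1/2} · 8T/(|c − D| + √(2T))`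
`  ≤ B² N (1 + log N)(8Λ_D (1 + log X)√(T/2π) + 24√π X)`, `Λ_D = 13 + 3 log X + 3 log(DN + 2)`.
[cite: Levinson1974, §5] -/
theorem sum_weight_kernel_le (a : ℕ → ℂ) (N X : ℕ) {T D B : ℝ} (hT : 0 < T) (hD : T ≤ D)
    (hB : ∀ h ∈ Finset.Icc 1 N, ‖a h‖ ≤ B) :
    ∑ h ∈ Finset.Icc 1 N, ∑ k ∈ Finset.Icc 1 N, ∑ μ ∈ Finset.Icc 1 X, ∑ ν ∈ Finset.Icc 1 X,
      ‖a h‖ * ‖a k‖ * ((h : ℝ) * k) ^ (-(1 / 2 : ℝ)) * ((μ : ℝ) * ν) ^ (-(1 / 2 : ℝ)) *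
        (8 * T / (|crossFreq h k μ ν - D| + Real.sqrt (2 * T))) ≤
      B ^ 2 * N * (1 + Real.log N) *
        (8 * (13 + 3 * Real.log X + 3 * Real.log (D * N + 2)) * (1 + Real.log X) * Real.sqrt (T / (2 * π)) +
          24 * Real.sqrt π * X) := by
  rcases Nat.eq_zero_or_pos N with rfl | hN
  · simp
  have hB0 : 0 ≤ B := le_trans (norm_nonneg _) (hB 1 (Finset.mem_Icc.2 ⟨le_rfl, hN⟩))
  have hD0 : 0 < D := lt_of_lt_of_le hT hD
  set c₁ : ℝ := 8 * (13 + 3 * Real.log X + 3 * Real.log (D * N + 2)) * Real.sqrt (T / (2 * π)) with hc₁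
  set c₂ : ℝ := 24 * Real.sqrt π with hc₂
  have hlogX : 0 ≤ Real.log (X : ℝ) := Real.log_natCast_nonneg X
  have hc₁0 : 0 ≤ c₁ := by
    rw [hc₁]
    have : 0 ≤ Real.log (D * N + 2) :=
      Real.log_nonneg (by nlinarith [hD0.le, (Nat.cast_nonneg N : (0:ℝ) ≤ N)])
    positivity
  have hc₂0 : 0 ≤ c₂ := by rw [hc₂]; positivity
  have hper : ∀ h ∈ Finset.Icc 1 N, ∀ k ∈ Finset.Icc 1 N, ∀ μ ∈ Finset.Icc 1 X,
      ∑ ν ∈ Finset.Icc 1 X, ‖a h‖ * ‖a k‖ * ((h : ℝ) * k) ^ (-(1 / 2 : ℝ)) * ((μ : ℝ) * ν) ^ (-(1 / 2 : ℝ)) *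
        (8 * T / (|crossFreq h k μ ν - D| + Real.sqrt (2 * T))) ≤
        B ^ 2 * (c₁ * (1 / ((h : ℝ) * μ)) + c₂ * (1 / (k : ℝ))) :=
    fun h hh k hk μ hμ => kernel_triple_le a hT hD hB0 (Finset.mem_Icc.1 hh).1 (Finset.mem_Icc.1 hk).1
      (Finset.mem_Icc.1 hμ).1 (Finset.mem_Icc.1 hk).2 (hB h hh) (hB k hk)
  have hHN : ∑ h ∈ Finset.Icc 1 N, 1 / (h : ℝ) ≤ 1 + Real.log N := sum_one_div_le_log N
  have hHX : ∑ μ ∈ Finset.Icc 1 X, 1 / (μ : ℝ) ≤ 1 + Real.log X := sum_one_div_le_log X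
  have hHN0 : 0 ≤ ∑ h ∈ Finset.Icc 1 N, 1 / (h : ℝ) := Finset.sum_nonneg fun h _ => by positivity
  have hHX0 : 0 ≤ ∑ μ ∈ Finset.Icc 1 X, 1 / (μ : ℝ) := Finset.sum_nonneg fun μ _ => by positivity
  -- the exact value of the triple sum of the bound
  have hsum : ∑ h ∈ Finset.Icc 1 N, ∑ k ∈ Finset.Icc 1 N, ∑ μ ∈ Finset.Icc 1 X,
      B ^ 2 * (c₁ * (1 / ((h : ℝ) * μ)) + c₂ * (1 / (k : ℝ))) =
      B ^ 2 * (c₁ * ((∑ h ∈ Finset.Icc 1 N, 1 / (h : ℝ)) * N * ∑ μ ∈ Finset.Icc 1 X, 1 / (μ : ℝ)) +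
        c₂ * (N * (∑ k ∈ Finset.Icc 1 N, 1 / (k : ℝ)) * X)) := by
    have e1 : ∀ h k μ : ℕ, B ^ 2 * (c₁ * (1 / ((h : ℝ) * μ)) + c₂ * (1 / (k : ℝ))) =
        B ^ 2 * c₁ * ((1 / (h : ℝ)) * (1 / (μ : ℝ))) + B ^ 2 * c₂ * (1 / (k : ℝ)) := by
      intro h k μ
      rw [one_div_mul_one_div]
      ring
    simp_rw [e1, Finset.sum_add_distrib, Finset.sum_const, nsmul_eq_mul, ← Finset.mul_sum, Nat.card_Icc,
      Nat.add_sub_cancel]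
    rw [← Finset.sum_mul]
    ring
  calc ∑ h ∈ Finset.Icc 1 N, ∑ k ∈ Finset.Icc 1 N, ∑ μ ∈ Finset.Icc 1 X, ∑ ν ∈ Finset.Icc 1 X,
        ‖a h‖ * ‖a k‖ * ((h : ℝ) * k) ^ (-(1 / 2 : ℝ)) * ((μ : ℝ) * ν) ^ (-(1 / 2 : ℝ)) *
          (8 * T / (|crossFreq h k μ ν - D| + Real.sqrt (2 * T)))
      ≤ ∑ h ∈ Finset.Icc 1 N, ∑ k ∈ Finset.Icc 1 N, ∑ μ ∈ Finset.Icc 1 X,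
          B ^ 2 * (c₁ * (1 / ((h : ℝ) * μ)) + c₂ * (1 / (k : ℝ))) :=
        Finset.sum_le_sum fun h hh => Finset.sum_le_sum fun k hk => Finset.sum_le_sum fun μ hμ =>
          hper h hh k hk μ hμ
    _ = B ^ 2 * (c₁ * ((∑ h ∈ Finset.Icc 1 N, 1 / (h : ℝ)) * N * ∑ μ ∈ Finset.Icc 1 X, 1 / (μ : ℝ)) +
          c₂ * (N * (∑ k ∈ Finset.Icc 1 N, 1 / (k : ℝ)) * X)) := hsum
    _ ≤ B ^ 2 * (c₁ * ((1 + Real.log N) * N * (1 + Real.log X)) + c₂ * (N * (1 + Real.log N) * X)) := by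
        gcongr
    _ = B ^ 2 * N * (1 + Real.log N) *
        (8 * (13 + 3 * Real.log X + 3 * Real.log (D * N + 2)) * (1 + Real.log X) * Real.sqrt (T / (2 * π)) +
          24 * Real.sqrt π * X) := by
        rw [hc₁, hc₂]; ring

end Literature.NumberTheory.LFunctions.BCH
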